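import Mathlib
import HarnessLib
import Literature.Analysis.FluidPDE.StretchingRate
import Literature.Analysis.FluidPDE.ParabolicComparison
import Summits.NavierStokesRegularity.NavierStokesRegularity.Theorems.AdaptedFrequencyEnstrophyDensity

/-!
# Crux `IsobarTomography.BlobRiccatiClosure` (stmt-NavierStokesRegularity-11740), line `Sketch`,
# stub S3 `stub_peakGrowth` — growth of the squared vorticity at a spatial maximum

Registered stub S3 of the peak-reduction skeleton: for a classical solution `(u, p)` of the
unforced Navier–Stokes system with viscosity `ν ≥ 0` on `ℝ³ × [0, T)`, at every time
`t ∈ [0, T)` and every spatial maximum point `x⋆` of `y ↦ ‖curl u(t, y)‖²`,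

  `∂ₜ‖ω‖²(t, x⋆) ≤ 2 ‖ω(t, x⋆)‖² α(t, x⋆)`,

where `ω = curl u`, `α = stretchingRate` is the vortex-stretching rate `⟪ξ, (∇u) ξ⟫` and `∂ₜ` is
the one-sided time derivative within `[0, T)` (`timeDerivWithin (Ico 0 T)`).

Proof (every ingredient is a theorem of the tree): the enstrophy-density identity
`∂ₜ‖ω‖² + D‖ω‖²·u − νΔ‖ω‖² = 2⟪ω, ∇u ω⟫ − 2ν|∇ω|²_F` (`opL_norm_curl_sq_eq`,
Majda–Bertozzi (2.110)); at a spatial maximum `x⋆` of the `C²` function `‖ω(t, ·)‖²` the first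
order condition `D‖ω‖²(x⋆) = 0` (`IsLocalMax.fderiv_eq_zero`) kills the transport term and the
second-order condition `Δ‖ω‖²(x⋆) ≤ 0` (`IsLocalMax.laplacian_nonpos`) together with `ν ≥ 0`,
`|∇ω|²_F ≥ 0` signs the viscous terms; finally `⟪ω, ∇u ω⟫ = ‖ω‖² α`
(`norm_curl_sq_mul_stretchingRate`, Majda–Bertozzi (5.8)–(5.9)).

References: A. J. Majda, A. L. Bertozzi, *Vorticity and Incompressible Flow* (CUP 2002), §2.4
eq. (2.110), §5.1 eqs. (5.8)–(5.12); P. Constantin, C. Fefferman, Indiana Univ. Math. J. 42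
(1993) 775–789, §1.
-/

noncomputable section

open Set Function Filter Topology
open scoped InnerProductSpace RealInnerProductSpace Laplacian ContDiff

-- the summit and its single sub-problem share the name (CONVENTIONS §1), as in every Theorems file
set_option linter.dupNamespace false

namespace Summit.NavierStokesRegularity.NavierStokesRegularity.Theorems.BlobRiccatiClosure.Sketch

open Literature.Analysis Literature.Analysis.FluidPDE
open Summit.NavierStokesRegularity.NavierStokesRegularity.Theorems

local notation "E³" => EuclideanSpace ℝ (Fin 3)

/-- **S3, PEAK GROWTH INEQUALITY.** For a classical solution of unforced Navier–Stokes (`ν ≥ 0`) on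
`[0, T)`, at every `t ∈ [0, T)` and every spatial maximum point `x⋆` of `‖curl u(t, ·)‖²`:
`∂ₜ‖ω‖²(t, x⋆) ≤ 2 ‖ω(t,x⋆)‖² α(t,x⋆)`, `α = stretchingRate` (one-sided time derivative within
`[0, T)`). From the enstrophy-density identity `opL_norm_curl_sq_eq`
(`∂ₜ‖ω‖² + D‖ω‖²·u − νΔ‖ω‖² = 2⟪ω, ∇u ω⟫ − 2ν|∇ω|²_F`) with `D‖ω‖²(x⋆) = 0`, `Δ‖ω‖²(x⋆) ≤ 0`
(`IsLocalMax.laplacian_nonpos`) and `⟪ω, ∇u ω⟫ = ‖ω‖² α` (`norm_curl_sq_mul_stretchingRate`). -/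
theorem stub_peakGrowth :
    ∀ (ν T : ℝ) (u : ℝ → E³ → E³) (p : ℝ → E³ → ℝ), 0 ≤ ν → 0 < T →
      IsClassicalNSSolutionOn (Ico 0 T) ν 0 u p →
      ∀ t ∈ Ico 0 T, ∀ x : E³, IsMaxOn (fun y => ‖curl (u t) y‖ ^ 2) univ x →
        timeDerivWithin (Ico 0 T) (fun s y => ‖curl (u s) y‖ ^ 2) t x ≤
          2 * (‖curl (u t) x‖ ^ 2 * stretchingRate (u t) x) := by
  intro ν T u p hν _hT hsol t ht x hmax
  -- the enstrophy-density identity at `(t, x)`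
  have hid := opL_norm_curl_sq_eq hsol (uniqueDiffOn_Ico 0 T) ht x
  -- `y ↦ ‖curl (u t) y‖²` is `C²`
  have hW2 : ContDiff ℝ 2 (fun y => ‖curl (u t) y‖ ^ 2) :=
    (contDiff_two_vorticity_of_classical hsol ht).norm_sq ℝ
  -- first- and second-order conditions at the maximum `x`
  have hloc : IsLocalMax (fun y => ‖curl (u t) y‖ ^ 2) x := hmax.isLocalMax univ_mem
  have hD : fderiv ℝ (fun y => ‖curl (u t) y‖ ^ 2) x = 0 := hloc.fderiv_eq_zero
  have hΔ : (Δ fun y => ‖curl (u t) y‖ ^ 2) x ≤ 0 := IsLocalMax.laplacian_nonpos hW2 hloc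
  have hνΔ : ν * (Δ fun y => ‖curl (u t) y‖ ^ 2) x ≤ 0 := mul_nonpos_of_nonneg_of_nonpos hν hΔ
  have hνF : 0 ≤ ν * frobeniusNormSq (fderiv ℝ (curl (u t)) x) :=
    mul_nonneg hν (frobeniusNormSq_nonneg _)
  have h0 : fderiv ℝ (fun y => ‖curl (u t) y‖ ^ 2) x (u t x) = 0 := by simp [hD]
  rw [norm_curl_sq_mul_stretchingRate]
  linarith

end Summit.NavierStokesRegularity.NavierStokesRegularity.Theorems.BlobRiccatiClosure.Sketch

end
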